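import Summits.MatrixMultiplication.OmegaCensus.STPPVosperPrimeTableLaw
import Summits.MatrixMultiplication.OmegaCensus.STPPVosperSlackOneLawMult
import Summits.MatrixMultiplication.OmegaCensus.STPPHamidouneRodsethInverseTheorem
import Summits.MatrixMultiplication.OmegaCensus.STPP222SqSymmetry
import Summits.MatrixMultiplication.OmegaCensus.STPPDisjointPacking
import Summits.MatrixMultiplication.OmegaCensus.STPPKernelListerLeaf

/-!
# ω-census (abelian STPP census): `ℤ₅₃` — four of the six tree-law survivors killed by Vosper laws (kernel, unconditional)

HONEST FRAMING (pub-omega census; verbatim): lottery ticket; floor = certified bounds/negative ranges.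
Census STRUCTURE (seat pub-omega-stpp-2 gen 30, 2026-08-29), family (b2).  Nothing here is progress on `ω` — every theorem EXCLUDES one size pattern of
simultaneous-triple-product families of `ℤ/53` (CKSU Def. 5.1).

The kernel lister at order `53` (tree laws only; python twin, DATUM HOME `pub-omega-stpp-2-g30/FRONTS-1-58.md`) leaves exactly six minimal beating size
patterns (canonical classes, all block counts, all entries): `{(2,3,4),(2,3,5)}`, `{(3,3,3),(3,3,3)}`, `{(2,2,3),(3,3,2),(3,4,2)}`, `{(2,3,3),(2,3,3),(2,3,3)}`,
`{(2,3,3),(2,3,3),(3,2,3)}`, `{(2,3,3),(3,2,3),(3,3,2)}` (volume `54 = 53 + 1` each).  This file kills FOUR of them in `ℤ/53` with the tree's prime-order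
Vosper laws (finite tables decided in the kernel; python mirrors HOME `pub-omega-stpp-1-g30/code/lean_tables.py` all pass):
* `{(2,3,4),(2,3,5)}` — tight table law (`STPPVosperPrimeTableLaw`), reading `(a,b,c)`, block `1` = `(2,3,5)`: `(z, b, vol, a, L) = (8, 3, 30, 2, 12)`,
  `8+3+30+2+12 = 55 = 53+2`, `(m, n) = (13, 43)`, table `(43, 13, 3)`;
* `{(2,2,3),(3,3,2),(3,4,2)}` — tight table law, reading `(b,c,a)` (`stpp_rotate`), block `2` = `(4,2,3)`: `(z, b, vol, a, L) = (13, 2, 24, 4, 12)`,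
  `55 = 53+2`, `(m, n) = (15, 39)`, table `(39, 15, 2)`;
* `{(2,3,3),(2,3,3),(3,2,3)}` — slack-1 law with the enlarged target (`STPPVosperSlackOneLawMult`, Hamidoune–Rødseth discharged by
  `hamidouneRodsethInverseTheorem_holds`), reading `(c,a,b)`, block `2` = `(3,3,2)`: `(z, b, vol, a, L) = (18, 3, 18, 3, 12)`, `54 = 53+1`, `(m, n) = (14, 32)`,
  target `{0, ±1, ±2, ±2⁻¹} = {0, 1, 52, 2, 51, 27, 26}`, tables γ `(32,14,3)`, α `(33,16,3)`, β `(33,14,3)`;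
* `{(2,3,3),(3,2,3),(3,3,2)}` — the same law, reading `(a,b,c)`, block `2` = `(3,3,2)`: `(z, b, vol, a, L) = (15, 3, 18, 3, 15)`, `(m, n) = (17, 35)`, tables
  γ `(35,17,3)`, α `(36,19,3)`, β `(36,17,3)`.
NOT killed here (no tight or slack-1 reading): `{(3,3,3),(3,3,3)}` (N18 slack 4 in every reading) and `{(2,3,3),(2,3,3),(2,3,3)}` (slack 2) — they need
the slack-2 / slack-4 machinery of the ℤ₅₉/ℤ₆₁ programme (`STPPVosperSlackTwo*`, `STPPVosperSlackFour*`).  Census reading: ℤ₅₃ front 4/6 KERNEL-dead.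
The `¬ KLister.Realizable (ZMod 53)` forms are supplied for a future order-53 lister capstone.

References: A. G. Vosper, J. London Math. Soc. 31 (1956); M. B. Nathanson, GTM 165, Thm 2.7; Y. O. Hamidoune, Ø. J. Rødseth, Acta Arith. 92 (2000)
251–262; H. Cohn, R. Kleinberg, B. Szegedy, C. Umans, FOCS 2005 (arXiv:math/0511460), Def. 5.1.
-/

open Finset
open scoped Pointwise

namespace Summit.MatrixMultiplication.OmegaCensus.CubeNB

open Literature.Computability.AlgebraicComplexity
open Literature.Combinatorics.Additive
open Summit.MatrixMultiplication.OmegaCensus.STPPKneser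

/-! ## Tables (`decide` / `decide +kernel`) -/

section Tables

/-- Tight table `(n, m, r) = (43, 13, 3)` at order `53` (target `{0, 1, 52}`). [folklore] -/
theorem table53_43_13_3 : ∀ j < 53, ∀ t < 53, (∀ i < 13, (t + j * i) % 53 < 43) →
    (∀ k < 13, 3 ∣ (t + j * k) % 53 - #((range 13).filter fun i => (t + j * i) % 53 < (t + j * k) % 53)) →
    j ∈ ({0, 1, 53 - 1} : Finset ℕ) := by
  decide +kernel

/-- Tight table `(n, m, r) = (39, 15, 2)` at order `53` (target `{0, 1, 52}`). [folklore] -/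
theorem table53_39_15_2 : ∀ j < 53, ∀ t < 53, (∀ i < 15, (t + j * i) % 53 < 39) →
    (∀ k < 15, 2 ∣ (t + j * k) % 53 - #((range 15).filter fun i => (t + j * i) % 53 < (t + j * k) % 53)) →
    j ∈ ({0, 1, 53 - 1} : Finset ℕ) := by
  decide +kernel


/-- The enlarged target at `53` for `(a, b) = (3, 3)`: every element is `0`, `±k` (`k < 3`) or `±k⁻¹` (`k < 3`) modulo `53`. [folklore] -/
theorem target53_a3_b3 : ∀ jv ∈ ({0, 1, 52, 2, 51, 27, 26} : Finset ℕ),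
    jv = 0 ∨ (∃ k ∈ range 3, 1 ≤ k ∧ (jv = k ∨ jv + k = 53)) ∨ (∃ k ∈ range 3, 1 ≤ k ∧ (jv * k % 53 = 1 ∨ jv * k % 53 = 53 - 1)) := by
  decide

/-- Tight-type table `(n, m, r) = (32, 14, 3)` at `53` with the enlarged target for `(a, b) = (3, 3)`. [folklore] -/
theorem table53_32_14_3_a3b3 : ∀ j < 53, ∀ t < 53, (∀ i < 14, (t + j * i) % 53 < 32) →
    (∀ k < 14, 3 ∣ (t + j * k) % 53 - #((range 14).filter fun i => (t + j * i) % 53 < (t + j * k) % 53)) →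
    j ∈ ({0, 1, 52, 2, 51, 27, 26} : Finset ℕ) := by
  decide +kernel

/-- Case-α table `(33, 16, 3)` at `53` with the enlarged target for `(a, b) = (3, 3)`. [folklore] -/
theorem tableAlpha53_33_16_3_a3b3 : tableAlpha 53 33 16 3 {0, 1, 52, 2, 51, 27, 26} = true := by
  decide +kernel

/-- Case-β table `(33, 14, 3)` at `53` with the enlarged target for `(a, b) = (3, 3)`. [folklore] -/
theorem tableBeta53_33_14_3_a3b3 : tableBeta 53 33 14 3 {0, 1, 52, 2, 51, 27, 26} = true := by
  decide +kernel

/-- Tight-type table `(n, m, r) = (35, 17, 3)` at `53` with the enlarged target for `(a, b) = (3, 3)`. [folklore] -/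
theorem table53_35_17_3_a3b3 : ∀ j < 53, ∀ t < 53, (∀ i < 17, (t + j * i) % 53 < 35) →
    (∀ k < 17, 3 ∣ (t + j * k) % 53 - #((range 17).filter fun i => (t + j * i) % 53 < (t + j * k) % 53)) →
    j ∈ ({0, 1, 52, 2, 51, 27, 26} : Finset ℕ) := by
  decide +kernel

/-- Case-α table `(36, 19, 3)` at `53` with the enlarged target for `(a, b) = (3, 3)`. [folklore] -/
theorem tableAlpha53_36_19_3_a3b3 : tableAlpha 53 36 19 3 {0, 1, 52, 2, 51, 27, 26} = true := by
  decide +kernel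

/-- Case-β table `(36, 17, 3)` at `53` with the enlarged target for `(a, b) = (3, 3)`. [folklore] -/
theorem tableBeta53_36_17_3_a3b3 : tableBeta 53 36 17 3 {0, 1, 52, 2, 51, 27, 26} = true := by
  decide +kernel

end Tables

/-! ## The kills -/

section Kills

/-- **`{(2,3,4), (2,3,5)}` has no STPP family in `ℤ/53ℤ`** (Vosper tight table law, reading `(a,b,c)`, tight block `1` = `(2,3,5)`,
`(z,b,vol,a,L) = (8,3,30,2,12)`, table `(43,13,3)`); kernel, unconditional. [cite: CohnKleinbergSzegedyUmans2005, Def. 5.1] [cite: Nathanson1996, Thm 2.7] -/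
theorem no_isSTPP_zmod53_234_235 (A B C : Fin 2 → Finset (ZMod 53)) (hS : IsSTPP A B C)
    (hA : ∀ i, #(A i) = ![2, 2] i) (hB : ∀ i, #(B i) = ![3, 3] i) (hC : ∀ i, #(C i) = ![4, 5] i) :
    False := by
  have hAne : ∀ i, (A i).Nonempty := fun i => card_pos.1 (by rw [hA]; fin_cases i <;> simp)
  have hBne : ∀ i, (B i).Nonempty := fun i => card_pos.1 (by rw [hB]; fin_cases i <;> simp)
  have hCne : ∀ i, (C i).Nonempty := fun i => card_pos.1 (by rw [hC]; fin_cases i <;> simp)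
  have e1 : (univ : Finset (Fin 2)).erase 1 = {0} := by decide
  have hz : ∑ k ∈ (univ : Finset (Fin 2)).erase 1, #(A k) * #(C k) = 8 := by
    rw [e1, Finset.sum_singleton]; simp [hA, hC]
  have hL : ∑ k ∈ (univ : Finset (Fin 2)).erase 1, #(B k) * #(C k) = 12 := by
    rw [e1, Finset.sum_singleton]; simp [hB, hC]
  have ha : #(A 1) = 2 := by rw [hA]; simp
  have hb : #(B 1) = 3 := by rw [hB]; simp
  have hvol : #(A 1) * #(B 1) * #(C 1) = 30 := by rw [hA, hB, hC]; simp
  haveI : Fact (Nat.Prime 53) := ⟨by norm_num⟩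
  exact no_isSTPP_of_tight_table_prime A B C hS hAne hBne hCne 1 ⟨0, by decide⟩ ha hb hvol hz hL (by norm_num)
    (by norm_num) (by norm_num) (by norm_num) (by norm_num) (m := 13) (n := 43) rfl rfl table53_43_13_3

/-- **`{(2,2,3), (3,3,2), (3,4,2)}` has no STPP family in `ℤ/53ℤ`** (Vosper tight table law in the reading `(b,c,a)`, i.e. for the STPP family
`(B, C, A)`, tight block `2` = `(4,2,3)`: `(z,b,vol,a,L) = (13,2,24,4,12)`, table `(39,15,2)`); kernel, unconditional.
[cite: CohnKleinbergSzegedyUmans2005, Def. 5.1] [cite: Nathanson1996, Thm 2.7] -/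
theorem no_isSTPP_zmod53_223_332_342 (A B C : Fin 3 → Finset (ZMod 53)) (hS : IsSTPP A B C)
    (hA : ∀ i, #(A i) = ![2, 3, 3] i) (hB : ∀ i, #(B i) = ![2, 3, 4] i) (hC : ∀ i, #(C i) = ![3, 2, 2] i) :
    False := by
  have hS' : IsSTPP B C A := stpp_rotate hS
  have hAne : ∀ i, (A i).Nonempty := fun i => card_pos.1 (by rw [hA]; fin_cases i <;> simp)
  have hBne : ∀ i, (B i).Nonempty := fun i => card_pos.1 (by rw [hB]; fin_cases i <;> simp)
  have hCne : ∀ i, (C i).Nonempty := fun i => card_pos.1 (by rw [hC]; fin_cases i <;> simp)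
  have e2 : (univ : Finset (Fin 3)).erase 2 = {0, 1} := by decide
  have hz : ∑ k ∈ (univ : Finset (Fin 3)).erase 2, #(B k) * #(A k) = 13 := by
    rw [e2, Finset.sum_pair (by decide)]; simp [hB, hA]
  have hL : ∑ k ∈ (univ : Finset (Fin 3)).erase 2, #(C k) * #(A k) = 12 := by
    rw [e2, Finset.sum_pair (by decide)]; simp [hC, hA]
  have ha : #(B 2) = 4 := by rw [hB]; simp
  have hb : #(C 2) = 2 := by rw [hC]; simp
  have hvol : #(B 2) * #(C 2) * #(A 2) = 24 := by rw [hA, hB, hC]; simp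
  haveI : Fact (Nat.Prime 53) := ⟨by norm_num⟩
  exact no_isSTPP_of_tight_table_prime B C A hS' hBne hCne hAne 2 ⟨0, by decide⟩ ha hb hvol hz hL (by norm_num)
    (by norm_num) (by norm_num) (by norm_num) (by norm_num) (m := 15) (n := 39) rfl rfl table53_39_15_2


/-- **`{(2,3,3),(2,3,3),(3,2,3)}` has no STPP family in `ℤ/53ℤ`, kernel, UNCONDITIONAL** (Hamidoune–Rødseth discharged by `hamidouneRodsethInverseTheorem_holds`) (enlarged-target
slack-1 law, reading `(c,a,b)`, block `(3, 3, 2)`: `(z, b, vol, a, L) = (18, 3, 18, 3, 12)`, tables `(32,14,3)`, α `(33,16,3)`, β `(33,14,3)`,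
target `{0, 1, 52, 2, 51, 27, 26}`). [cite: CohnKleinbergSzegedyUmans2005, Def. 5.1] [cite: HamidouneRodseth2000, main theorem (§1, p. 252)] [cite: Nathanson1996, Thm 2.7] -/
theorem no_isSTPP_zmod53_233_233_323
    (A B C : Fin 3 → Finset (ZMod 53)) (hS : IsSTPP A B C)
    (hA : ∀ i, #(A i) = ![2, 2, 3] i) (hB : ∀ i, #(B i) = ![3, 3, 2] i) (hC : ∀ i, #(C i) = ![3, 3, 3] i) :
    False := by
  haveI : Fact (Nat.Prime 53) := ⟨by norm_num⟩
  have hAne : ∀ i, (A i).Nonempty := fun i => card_pos.1 (by rw [hA]; fin_cases i <;> simp)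
  have hBne : ∀ i, (B i).Nonempty := fun i => card_pos.1 (by rw [hB]; fin_cases i <;> simp)
  have hCne : ∀ i, (C i).Nonempty := fun i => card_pos.1 (by rw [hC]; fin_cases i <;> simp)
  have hS' : IsSTPP C A B := stpp_rotate (stpp_rotate hS)
  have e2 : (univ : Finset (Fin 3)).erase 2 = {0, 1} := by decide
  have hz : ∑ k ∈ (univ : Finset (Fin 3)).erase 2, #(C k) * #(B k) = 18 := by
    rw [e2, Finset.sum_pair (by decide)]; simp [hC, hB]
  have hL : ∑ k ∈ (univ : Finset (Fin 3)).erase 2, #(A k) * #(B k) = 12 := by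
    rw [e2, Finset.sum_pair (by decide)]; simp [hA, hB]
  have ha : #(C 2) = 3 := by rw [hC]; simp
  have hb : #(A 2) = 3 := by rw [hA]; simp
  have hvol : #(C 2) * #(A 2) * #(B 2) = 18 := by rw [hA, hB, hC]; simp
  exact no_isSTPP_of_slack_one_tables_prime_mult hamidouneRodsethInverseTheorem_holds C A B hS' hCne hAne hBne 2 ⟨0, by decide⟩ ha hb hvol hz hL
    (by norm_num) (by norm_num) (by norm_num) (by norm_num) (by norm_num) (m := 14) (n := 32) rfl rfl target53_a3_b3 table53_32_14_3_a3b3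
    tableAlpha53_33_16_3_a3b3 tableBeta53_33_14_3_a3b3

/-- **`{(2,3,3),(3,2,3),(3,3,2)}` has no STPP family in `ℤ/53ℤ`, kernel, UNCONDITIONAL** (Hamidoune–Rødseth discharged by `hamidouneRodsethInverseTheorem_holds`) (enlarged-target
slack-1 law, reading `(a,b,c)`, block `(3, 3, 2)`: `(z, b, vol, a, L) = (15, 3, 18, 3, 15)`, tables `(35,17,3)`, α `(36,19,3)`, β `(36,17,3)`,
target `{0, 1, 52, 2, 51, 27, 26}`). [cite: CohnKleinbergSzegedyUmans2005, Def. 5.1] [cite: HamidouneRodseth2000, main theorem (§1, p. 252)] [cite: Nathanson1996, Thm 2.7] -/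
theorem no_isSTPP_zmod53_233_323_332
    (A B C : Fin 3 → Finset (ZMod 53)) (hS : IsSTPP A B C)
    (hA : ∀ i, #(A i) = ![2, 3, 3] i) (hB : ∀ i, #(B i) = ![3, 2, 3] i) (hC : ∀ i, #(C i) = ![3, 3, 2] i) :
    False := by
  haveI : Fact (Nat.Prime 53) := ⟨by norm_num⟩
  have hAne : ∀ i, (A i).Nonempty := fun i => card_pos.1 (by rw [hA]; fin_cases i <;> simp)
  have hBne : ∀ i, (B i).Nonempty := fun i => card_pos.1 (by rw [hB]; fin_cases i <;> simp)
  have hCne : ∀ i, (C i).Nonempty := fun i => card_pos.1 (by rw [hC]; fin_cases i <;> simp)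
  have e2 : (univ : Finset (Fin 3)).erase 2 = {0, 1} := by decide
  have hz : ∑ k ∈ (univ : Finset (Fin 3)).erase 2, #(A k) * #(C k) = 15 := by
    rw [e2, Finset.sum_pair (by decide)]; simp [hA, hC]
  have hL : ∑ k ∈ (univ : Finset (Fin 3)).erase 2, #(B k) * #(C k) = 15 := by
    rw [e2, Finset.sum_pair (by decide)]; simp [hB, hC]
  have ha : #(A 2) = 3 := by rw [hA]; simp
  have hb : #(B 2) = 3 := by rw [hB]; simp
  have hvol : #(A 2) * #(B 2) * #(C 2) = 18 := by rw [hA, hB, hC]; simp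
  exact no_isSTPP_of_slack_one_tables_prime_mult hamidouneRodsethInverseTheorem_holds A B C hS hAne hBne hCne 2 ⟨0, by decide⟩ ha hb hvol hz hL (by norm_num) (by norm_num)
    (by norm_num) (by norm_num) (by norm_num) (m := 17) (n := 35) rfl rfl target53_a3_b3 table53_35_17_3_a3b3 tableAlpha53_36_19_3_a3b3
    tableBeta53_36_17_3_a3b3


end Kills

/-! ## Non-realisability forms (for the kernel lister's dead list at order 53) -/

section Dead

open Summit.MatrixMultiplication.OmegaCensus.KLister

/-- The class `234_235` is not realisable in `ℤ₅₃`. [cite: CohnKleinbergSzegedyUmans2005, Def. 5.1] -/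
theorem notRealizable_Z53_234_235 : ¬ Realizable (ZMod 53) ([(2, 3, 4), (2, 3, 5)] : List Shape) := by
  intro h
  obtain ⟨A, B, C, hS, hc⟩ := h.out
  exact no_isSTPP_zmod53_234_235 A B C hS (fun i => by fin_cases i <;> exact (hc _).2.2.2.1)
    (fun i => by fin_cases i <;> exact (hc _).2.2.2.2.1) (fun i => by fin_cases i <;> exact (hc _).2.2.2.2.2)

/-- The class `223_332_342` is not realisable in `ℤ₅₃`. [cite: CohnKleinbergSzegedyUmans2005, Def. 5.1] -/
theorem notRealizable_Z53_223_332_342 : ¬ Realizable (ZMod 53) ([(2, 2, 3), (3, 3, 2), (3, 4, 2)] : List Shape) := by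
  intro h
  obtain ⟨A, B, C, hS, hc⟩ := h.out
  exact no_isSTPP_zmod53_223_332_342 A B C hS (fun i => by fin_cases i <;> exact (hc _).2.2.2.1)
    (fun i => by fin_cases i <;> exact (hc _).2.2.2.2.1) (fun i => by fin_cases i <;> exact (hc _).2.2.2.2.2)

/-- The class `233_233_323` is not realisable in `ℤ₅₃`. [cite: CohnKleinbergSzegedyUmans2005, Def. 5.1] -/
theorem notRealizable_Z53_233_233_323 : ¬ Realizable (ZMod 53) ([(2, 3, 3), (2, 3, 3), (3, 2, 3)] : List Shape) := by
  intro h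
  obtain ⟨A, B, C, hS, hc⟩ := h.out
  exact no_isSTPP_zmod53_233_233_323 A B C hS (fun i => by fin_cases i <;> exact (hc _).2.2.2.1)
    (fun i => by fin_cases i <;> exact (hc _).2.2.2.2.1) (fun i => by fin_cases i <;> exact (hc _).2.2.2.2.2)

/-- The class `233_323_332` is not realisable in `ℤ₅₃`. [cite: CohnKleinbergSzegedyUmans2005, Def. 5.1] -/
theorem notRealizable_Z53_233_323_332 : ¬ Realizable (ZMod 53) ([(2, 3, 3), (3, 2, 3), (3, 3, 2)] : List Shape) := by
  intro h
  obtain ⟨A, B, C, hS, hc⟩ := h.out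
  exact no_isSTPP_zmod53_233_323_332 A B C hS (fun i => by fin_cases i <;> exact (hc _).2.2.2.1)
    (fun i => by fin_cases i <;> exact (hc _).2.2.2.2.1) (fun i => by fin_cases i <;> exact (hc _).2.2.2.2.2)

end Dead

end Summit.MatrixMultiplication.OmegaCensus.CubeNB
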